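import Mathlib

/-!
# De-risking `stub_stieltjesOfPencil` (line `cayley-pencil`, crux stmt-AtomisticToContinuum-15248):
# the operator algebra, sorry-free

For a family `W : ℝ → K →L[ℝ] K` on a real inner-product space with
(R) `W γ f - W γ' f = (γ' - γ) • W γ (W γ' f)` and (E) `⟪f, W γ f⟫ = γ ‖W γ f‖²` (`γ, γ' > 0`):

* `norm_apply_le` — `‖W γ f‖ ≤ ‖f‖ / γ` from (E) alone (no spectral gap needed);
* `norm_cayley` — the Cayley transform `C = 2 W 1 - 1` is an ISOMETRY, `‖C f‖ = ‖f‖` (Lax–Phillips Ch. II §3 (3.1));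
* `inner_cayley_cayley`, `inner_pow_pow` — `⟪C x, C y⟫ = ⟪x, y⟫`, `⟪C^(m+k) g, C^k g⟫ = ⟪C^m g, g⟫`;
* `apply_pencil_eq` — (R) with `γ' = 1` is `W γ ((γ+1) • h + (γ-1) • C h) = h + C h`;
* `telescope`, `resum` — the inverse-free resummation `(γ+1) • W γ (f - (-q)^n • C^n f) = S_n f + C (S_n f)`,
  `S_n = Σ_{k<n} (-q)^k C^k`, `q = (γ-1)/(γ+1)`, and the remainder bound `‖W γ ((-q)^n • C^n f)‖ ≤ |q|^n ‖f‖ / γ`;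
* `toeplitz_nonneg` — positive-definiteness of the real sequence `c_k = ⟪C^k g, g⟫`:
  `Σ_{m,n<M} a_m a_n c_{|m-n|} = ‖Σ_m a_m C^m g‖² ≥ 0` (the input of Herglotz's theorem).

What remains of the stub after this file: Herglotz (PD sequence → measure on the circle: Poisson means + Mathlib
Prokhorov, or triangle interpolation + the tree's `bochner_holds`), the change of variables `s = tan(θ/2)`, layer cake.
-/

noncomputable section

open scoped RealInnerProductSpace BigOperators
open Finset

namespace CayleyPencilAlgebra

variable {K : Type*} [NormedAddCommGroup K] [InnerProductSpace ℝ K]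

/-- The two pencil axioms (R) and (E). [folklore] -/
structure IsDissipativePencil (W : ℝ → K →L[ℝ] K) : Prop where
  resolvent : ∀ γ γ' : ℝ, 0 < γ → 0 < γ' → ∀ f : K, W γ f - W γ' f = (γ' - γ) • W γ (W γ' f)
  energy : ∀ γ : ℝ, 0 < γ → ∀ f : K, inner ℝ f (W γ f) = γ * ‖W γ f‖ ^ 2

variable {W : ℝ → K →L[ℝ] K}

/-- (E) alone bounds the family: `‖W γ f‖ ≤ ‖f‖ / γ` (Cauchy–Schwarz). [folklore] -/
theorem norm_apply_le (hW : IsDissipativePencil W) {γ : ℝ} (hγ : 0 < γ) (f : K) :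
    ‖W γ f‖ ≤ ‖f‖ / γ := by
  have h := hW.energy γ hγ f
  have hcs : inner ℝ f (W γ f) ≤ ‖f‖ * ‖W γ f‖ := real_inner_le_norm _ _
  rw [h] at hcs
  rw [le_div_iff₀ hγ]
  by_cases h0 : ‖W γ f‖ = 0
  · rw [h0, zero_mul]; exact norm_nonneg _
  · have hpos : 0 < ‖W γ f‖ := lt_of_le_of_ne (norm_nonneg _) (Ne.symm h0)
    have h2 : (‖W γ f‖ * γ) * ‖W γ f‖ ≤ ‖f‖ * ‖W γ f‖ := by nlinarith
    exact le_of_mul_le_mul_right h2 hpos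

/-- The Cayley transform `C = 2 W 1 - 1` of the pencil. [folklore] -/
def cayley (W : ℝ → K →L[ℝ] K) : K →L[ℝ] K := (2 : ℝ) • W 1 - ContinuousLinearMap.id ℝ K

/-- `cayley_apply` (line `cayley-pencil`, stub `stub_stieltjesOfPencil` support). [folklore] -/
theorem cayley_apply (f : K) : cayley W f = (2 : ℝ) • W 1 f - f := rfl

/-- (E) at `γ = 1` makes the Cayley transform an ISOMETRY: `‖C f‖² = 4‖W₁f‖² - 4⟪W₁ f, f⟫ + ‖f‖² = ‖f‖²`. [folklore] -/
theorem norm_cayley (hW : IsDissipativePencil W) (f : K) : ‖cayley W f‖ = ‖f‖ := by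
  have h1 : inner ℝ f (W 1 f) = ‖W 1 f‖ ^ 2 := by
    have := hW.energy 1 one_pos f; rwa [one_mul] at this
  have hsq : ‖cayley W f‖ ^ 2 = ‖f‖ ^ 2 := by
    have e : ‖cayley W f‖ ^ 2 = ‖(2 : ℝ) • W 1 f‖ ^ 2 - 2 * inner ℝ ((2 : ℝ) • W 1 f) f + ‖f‖ ^ 2 := by
      rw [cayley_apply]; exact norm_sub_sq_real _ _
    rw [e, norm_smul, real_inner_smul_left, real_inner_comm, h1, Real.norm_eq_abs,
      abs_of_pos (by norm_num : (0:ℝ) < 2)]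
    ring
  have h0 : 0 ≤ ‖cayley W f‖ := norm_nonneg _
  have h0' : 0 ≤ ‖f‖ := norm_nonneg _
  nlinarith [hsq, sq_nonneg (‖cayley W f‖ - ‖f‖), sq_nonneg (‖cayley W f‖ + ‖f‖)]

/-- The Cayley transform as a linear isometry. [folklore] -/
def cayleyIso (hW : IsDissipativePencil W) : K →ₗᵢ[ℝ] K :=
  { toLinearMap := (cayley W : K →L[ℝ] K)
    norm_map' := norm_cayley hW }

/-- `cayleyIso_apply` (line `cayley-pencil`, stub `stub_stieltjesOfPencil` support). [folklore] -/
theorem cayleyIso_apply (hW : IsDissipativePencil W) (f : K) : cayleyIso hW f = cayley W f := rfl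

/-- Isometries preserve inner products: `⟪C x, C y⟫ = ⟪x, y⟫`. [folklore] -/
theorem inner_cayley_cayley (hW : IsDissipativePencil W) (x y : K) :
    inner ℝ (cayley W x) (cayley W y) = inner ℝ x y := by
  rw [← cayleyIso_apply hW, ← cayleyIso_apply hW]
  exact (cayleyIso hW).inner_map_map x y

/-- `pow_succ_apply` (line `cayley-pencil`, stub `stub_stieltjesOfPencil` support). [folklore] -/
theorem pow_succ_apply (n : ℕ) (f : K) : (cayley W ^ (n + 1)) f = cayley W ((cayley W ^ n) f) := by
  rw [pow_succ']; rfl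

/-- Powers of the Cayley transform are isometric. [folklore] -/
theorem norm_pow_apply (hW : IsDissipativePencil W) (n : ℕ) (f : K) : ‖(cayley W ^ n) f‖ = ‖f‖ := by
  induction n with
  | zero => simp
  | succ n ih => rw [pow_succ_apply, norm_cayley hW, ih]

/-- The moment structure of an isometry: `⟪C^(m+k) g, C^k g⟫ = ⟪C^m g, g⟫`. [folklore] -/
theorem inner_pow_pow (hW : IsDissipativePencil W) (m k : ℕ) (g : K) :
    inner ℝ ((cayley W ^ (m + k)) g) ((cayley W ^ k) g) = inner ℝ ((cayley W ^ m) g) g := by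
  induction k with
  | zero => simp
  | succ k ih =>
    rw [show m + (k + 1) = (m + k) + 1 by ring, pow_succ_apply, pow_succ_apply, inner_cayley_cayley hW, ih]

/-- (R) with `γ' = 1`, rewritten through `C`: `W γ ((γ+1) • h + (γ-1) • C h) = h + C h`
(i.e. `W γ ∘ ((γ+1) + (γ-1) C) = 1 + C`). [folklore] -/
theorem apply_pencil_eq (hW : IsDissipativePencil W) {γ : ℝ} (hγ : 0 < γ) (h : K) :
    W γ ((γ + 1) • h + (γ - 1) • cayley W h) = h + cayley W h := by
  have hR := hW.resolvent γ 1 hγ one_pos h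
  -- `hR : W γ h - W 1 h = (1 - γ) • W γ (W 1 h)`
  have key : (γ - 1) • W γ (W 1 h) = W 1 h - W γ h := by
    have e : (γ - 1) • W γ (W 1 h) = -((1 - γ) • W γ (W 1 h)) := by rw [← neg_smul, neg_sub]
    rw [e, ← hR, neg_sub]
  calc W γ ((γ + 1) • h + (γ - 1) • cayley W h)
      = W γ ((2 : ℝ) • h + (2 : ℝ) • ((γ - 1) • W 1 h)) := by
        congr 1; rw [cayley_apply]; module
    _ = (2 : ℝ) • W γ h + (2 : ℝ) • ((γ - 1) • W γ (W 1 h)) := by simp only [map_add, map_smul]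
    _ = (2 : ℝ) • W γ h + (2 : ℝ) • (W 1 h - W γ h) := by rw [key]
    _ = h + cayley W h := by rw [cayley_apply]; module

/-- The Cayley–Neumann ratio `q = (γ-1)/(γ+1)` has `|q| < 1` for `γ > 0`. [folklore] -/
theorem abs_ratio_lt_one {γ : ℝ} (hγ : 0 < γ) : |(γ - 1) / (γ + 1)| < 1 := by
  rw [abs_div, abs_of_pos (by linarith : 0 < γ + 1), div_lt_one (by linarith)]
  exact abs_sub_lt_iff.mpr ⟨by linarith, by linarith⟩

/-- The partial sums `S_n f = Σ_{k<n} (-q)^k C^k f`. [folklore] -/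
def partialSum (W : ℝ → K →L[ℝ] K) (q : ℝ) (n : ℕ) (f : K) : K :=
  ∑ k ∈ range n, (-q) ^ k • (cayley W ^ k) f

/-- Telescoping: `S_n f + q • C (S_n f) = f - (-q)^n • C^n f`. [folklore] -/
theorem telescope (q : ℝ) (n : ℕ) (f : K) :
    partialSum W q n f + q • cayley W (partialSum W q n f) = f - (-q) ^ n • (cayley W ^ n) f := by
  induction n with
  | zero => simp [partialSum]
  | succ n ih =>
    have hS : partialSum W q (n + 1) f = partialSum W q n f + (-q) ^ n • (cayley W ^ n) f := by
      simp [partialSum, sum_range_succ]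
    rw [hS, map_add, map_smul, smul_add, pow_succ_apply]
    have e : partialSum W q n f + (-q) ^ n • (cayley W ^ n) f +
        (q • cayley W (partialSum W q n f) + q • (-q) ^ n • cayley W ((cayley W ^ n) f)) =
        (partialSum W q n f + q • cayley W (partialSum W q n f)) + (-q) ^ n • (cayley W ^ n) f +
          (q * (-q) ^ n) • cayley W ((cayley W ^ n) f) := by
      rw [smul_smul]; abel
    rw [e, ih, show q * (-q) ^ n = -((-q) ^ (n + 1)) by ring]
    module

/-- **Inverse-free resummation** of `W γ` through the Cayley transform:
`(γ+1) • W γ (f - (-q)^n • C^n f) = S_n f + C (S_n f)`, `q = (γ-1)/(γ+1)`. [folklore] -/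
theorem resum (hW : IsDissipativePencil W) {γ : ℝ} (hγ : 0 < γ) (n : ℕ) (f : K) :
    (γ + 1) • W γ (f - (-((γ - 1) / (γ + 1))) ^ n • (cayley W ^ n) f) =
      partialSum W ((γ - 1) / (γ + 1)) n f + cayley W (partialSum W ((γ - 1) / (γ + 1)) n f) := by
  set q : ℝ := (γ - 1) / (γ + 1) with hq
  have hγ1 : (γ + 1) ≠ 0 := by linarith
  have hp := apply_pencil_eq hW hγ (partialSum W q n f)
  have e : (γ + 1) • partialSum W q n f + (γ - 1) • cayley W (partialSum W q n f) =
      (γ + 1) • (partialSum W q n f + q • cayley W (partialSum W q n f)) := by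
    rw [smul_add, smul_smul, hq, mul_div_cancel₀ _ hγ1]
  rw [e, telescope, map_smul] at hp
  exact hp

/-- The remainder of the resummation is geometrically small: `‖W γ ((-q)^n • C^n f)‖ ≤ |q|^n ‖f‖ / γ`. [folklore] -/
theorem norm_remainder_le (hW : IsDissipativePencil W) {γ : ℝ} (hγ : 0 < γ) (q : ℝ) (n : ℕ) (f : K) :
    ‖W γ ((-q) ^ n • (cayley W ^ n) f)‖ ≤ |q| ^ n * ‖f‖ / γ := by
  have h := norm_apply_le hW hγ ((-q) ^ n • (cayley W ^ n) f)
  rw [norm_smul, norm_pow_apply hW, norm_pow, norm_neg, Real.norm_eq_abs] at h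
  exact h

/-- Convergence of the resummation: the remainders tend to `0`, so
`(γ+1) ⟪g, W γ g⟫ = lim_n ⟪g, S_n g + C (S_n g)⟫`. [folklore] -/
theorem tendsto_remainder (hW : IsDissipativePencil W) {γ : ℝ} (hγ : 0 < γ) (f : K) :
    Filter.Tendsto (fun n : ℕ => W γ ((-((γ - 1) / (γ + 1))) ^ n • (cayley W ^ n) f))
      Filter.atTop (nhds 0) := by
  rw [tendsto_zero_iff_norm_tendsto_zero]
  have hq := abs_ratio_lt_one hγ
  have hlim : Filter.Tendsto (fun n : ℕ => |(γ - 1) / (γ + 1)| ^ n * ‖f‖ / γ) Filter.atTop (nhds 0) := by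
    have := (tendsto_pow_atTop_nhds_zero_of_lt_one (abs_nonneg _) hq).mul_const (‖f‖ / γ)
    rw [zero_mul] at this
    refine this.congr fun n => ?_
    ring
  refine squeeze_zero (fun n => norm_nonneg _) (fun n => ?_) hlim
  exact norm_remainder_le hW hγ _ n f

/-- **Positive-definiteness of the Cayley moment sequence** `c_k = ⟪C^k g, g⟫` (real, symmetric in `k ↦ -k`):
for every real `a` and `M`, `Σ_{m,n<M} a_m a_n c_{|m-n|} = ‖Σ_m a_m C^m g‖² ≥ 0`. [folklore] -/
theorem toeplitz_nonneg (hW : IsDissipativePencil W) (g : K) (a : ℕ → ℝ) (M : ℕ) :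
    0 ≤ ∑ m ∈ range M, ∑ n ∈ range M,
      a m * a n * inner ℝ ((cayley W ^ (max m n - min m n)) g) g := by
  have hterm : ∀ m n : ℕ, inner ℝ ((cayley W ^ (max m n - min m n)) g) g =
      inner ℝ ((cayley W ^ m) g) ((cayley W ^ n) g) := by
    intro m n
    rcases le_total n m with hnm | hmn
    · rw [max_eq_left hnm, min_eq_right hnm, ← inner_pow_pow hW (m - n) n g, Nat.sub_add_cancel hnm]
    · rw [max_eq_right hmn, min_eq_left hmn, ← inner_pow_pow hW (n - m) m g, Nat.sub_add_cancel hmn,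
        real_inner_comm]
  have hsum : ∑ m ∈ range M, ∑ n ∈ range M, a m * a n * inner ℝ ((cayley W ^ (max m n - min m n)) g) g =
      inner ℝ (∑ m ∈ range M, a m • (cayley W ^ m) g) (∑ n ∈ range M, a n • (cayley W ^ n) g) := by
    rw [sum_inner]
    refine sum_congr rfl fun m _ => ?_
    rw [inner_sum]
    refine sum_congr rfl fun n _ => ?_
    rw [hterm, real_inner_smul_left, real_inner_smul_right]
    ring
  rw [hsum]
  exact real_inner_self_nonneg

end CayleyPencilAlgebra

end

/-!
# Herglotz's theorem for positive-definite real sequences, via Fejér means (for `stub_stieltjesOfPencil`)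

For `c : ℕ → ℝ` with the Toeplitz forms `Σ_{m,n<M} a_m a_n c_{|m-n|}` nonnegative there is a finite positive
measure `ρ` on `ℝ` (carried by `[-π, π]`) with `∫ cos(k θ) dρ = c_k` for every `k` and total mass `c_0`.
Proof: the Fejér means `σ_M(θ) = M⁻¹ Σ_{m,n<M} c_{|m-n|} cos((m-n)θ) = c_0 + 2Σ_{1≤k<M}(1-k/M) c_k cos kθ` are
nonnegative (two Toeplitz forms with `a_m = cos mθ`, `b_m = sin mθ`), the measures `σ_M dθ/2π` have moments
`(1-k/M)₊ c_k`, are supported in `[-π,π]` (tight), and a Prokhorov subsequential limit has moments `c_k`.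
-/

noncomputable section

open scoped BigOperators Real Topology ENNReal
open Finset MeasureTheory Filter

namespace CayleyPencilHerglotz

/-! ### Elementary consequences of Toeplitz positivity -/

/-- Toeplitz positivity of a real sequence (symmetric extension understood). [folklore] -/
def IsToeplitzPSD (c : ℕ → ℝ) : Prop :=
  ∀ (a : ℕ → ℝ) (M : ℕ), 0 ≤ ∑ m ∈ range M, ∑ n ∈ range M, a m * a n * c (max m n - min m n)

/-- `IsToeplitzPSD.zero_nonneg` (line `cayley-pencil`, stub `stub_stieltjesOfPencil` support). [folklore] -/
theorem IsToeplitzPSD.zero_nonneg {c : ℕ → ℝ} (hc : IsToeplitzPSD c) : 0 ≤ c 0 := by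
  have h := hc (fun _ => 1) 1
  simpa using h

/-- `|c k| ≤ c 0` (the `2 × 2` Toeplitz minors at lags `0, k`). [folklore] -/
theorem IsToeplitzPSD.abs_le {c : ℕ → ℝ} (hc : IsToeplitzPSD c) (k : ℕ) : |c k| ≤ c 0 := by
  rcases Nat.eq_zero_or_pos k with rfl | hk
  · exact (abs_of_nonneg hc.zero_nonneg).le
  -- coefficients supported on `{0, k}`
  have key : ∀ s : ℝ, s = 1 ∨ s = -1 →
      ∑ m ∈ range (k + 1), ∑ n ∈ range (k + 1),
        (fun i => if i = 0 then (1:ℝ) else if i = k then s else 0) m *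
        (fun i => if i = 0 then (1:ℝ) else if i = k then s else 0) n * c (max m n - min m n) =
      2 * c 0 + 2 * s * c k := by
    intro s hs
    have hs2 : s * s = 1 := by rcases hs with rfl | rfl <;> norm_num
    have hk0 : k ≠ 0 := hk.ne'
    -- evaluate the double sum: only `(0,0), (0,k), (k,0), (k,k)` contribute
    have inner_eval : ∀ m : ℕ, m ∈ range (k + 1) →
        ∑ n ∈ range (k + 1),
          (fun i => if i = 0 then (1:ℝ) else if i = k then s else 0) m *
          (fun i => if i = 0 then (1:ℝ) else if i = k then s else 0) n * c (max m n - min m n) =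
        (fun i => if i = 0 then (1:ℝ) else if i = k then s else 0) m *
          (c (max m 0 - min m 0) + s * c (max m k - min m k)) := by
      intro m hm
      have h0 : (0 : ℕ) ∈ range (k + 1) := by simp
      have hkk : k ∈ range (k + 1) := by simp
      rw [← Finset.add_sum_erase _ _ h0]
      have hk' : k ∈ (range (k + 1)).erase 0 := by simp [hk0]
      rw [← Finset.add_sum_erase _ _ hk']
      have hrest : ∑ n ∈ ((range (k + 1)).erase 0).erase k,
          (fun i => if i = 0 then (1:ℝ) else if i = k then s else 0) m *
          (fun i => if i = 0 then (1:ℝ) else if i = k then s else 0) n * c (max m n - min m n) = 0 := by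
        refine Finset.sum_eq_zero fun n hn => ?_
        simp only [mem_erase, mem_range] at hn
        have h1 : n ≠ k := hn.1
        have h2 : n ≠ 0 := hn.2.1
        simp [h1, h2]
      rw [hrest]
      simp only [if_true, hk0, if_false]
      ring
    rw [Finset.sum_congr rfl inner_eval]
    have h0 : (0 : ℕ) ∈ range (k + 1) := by simp
    rw [← Finset.add_sum_erase _ _ h0]
    have hk' : k ∈ (range (k + 1)).erase 0 := by simp [hk0]
    rw [← Finset.add_sum_erase _ _ hk']
    have hrest : ∑ m ∈ ((range (k + 1)).erase 0).erase k,
        (fun i => if i = 0 then (1:ℝ) else if i = k then s else 0) m *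
          (c (max m 0 - min m 0) + s * c (max m k - min m k)) = 0 := by
      refine Finset.sum_eq_zero fun m hm => ?_
      simp only [mem_erase, mem_range] at hm
      simp [hm.1, hm.2.1]
    rw [hrest]
    simp only [if_true, hk0, if_false, max_self, min_self, Nat.sub_self, Nat.max_eq_left (Nat.zero_le k),
      Nat.min_eq_right (Nat.zero_le k), max_eq_right (Nat.zero_le k), min_eq_left (Nat.zero_le k),
      Nat.sub_zero]
    have : s * (c k) + s * (c 0 + s * c 0) = s * c k + s * c 0 + c 0 := by rw [mul_add, ← mul_assoc, hs2]; ring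
    nlinarith [this, hs2]
  have hp := hc (fun i => if i = 0 then (1:ℝ) else if i = k then 1 else 0) (k + 1)
  have hm := hc (fun i => if i = 0 then (1:ℝ) else if i = k then -1 else 0) (k + 1)
  rw [key 1 (Or.inl rfl)] at hp
  rw [key (-1) (Or.inr rfl)] at hm
  rw [_root_.abs_le]; constructor <;> linarith

/-! ### The Fejér means -/

/-- `cos((max m n - min m n) θ) = cos(mθ) cos(nθ) + sin(mθ) sin(nθ)`. [folklore] -/
theorem cos_absdiff_mul (m n : ℕ) (θ : ℝ) :
    Real.cos (((max m n - min m n : ℕ) : ℝ) * θ) =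
      Real.cos (m * θ) * Real.cos (n * θ) + Real.sin (m * θ) * Real.sin (n * θ) := by
  rcases le_total n m with h | h
  · rw [max_eq_left h, min_eq_right h, Nat.cast_sub h, sub_mul, Real.cos_sub]
  · rw [max_eq_right h, min_eq_left h, Nat.cast_sub h, sub_mul, Real.cos_sub]
    ring

/-- The (unnormalised) Fejér mean `F_M(θ) = Σ_{m,n<M} c_{|m-n|} cos((m-n)θ)`. [folklore] -/
def fejerSum (c : ℕ → ℝ) (M : ℕ) (θ : ℝ) : ℝ :=
  ∑ m ∈ range M, ∑ n ∈ range M, c (max m n - min m n) * Real.cos (((max m n - min m n : ℕ) : ℝ) * θ)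

/-- Positivity of the Fejér means: `F_M(θ) = Σ a a c + Σ b b c ≥ 0` with `a_m = cos mθ`, `b_m = sin mθ`. [folklore] -/
theorem fejerSum_nonneg {c : ℕ → ℝ} (hc : IsToeplitzPSD c) (M : ℕ) (θ : ℝ) : 0 ≤ fejerSum c M θ := by
  have h1 := hc (fun m => Real.cos (m * θ)) M
  have h2 := hc (fun m => Real.sin (m * θ)) M
  have e : fejerSum c M θ =
      (∑ m ∈ range M, ∑ n ∈ range M, Real.cos (m * θ) * Real.cos (n * θ) * c (max m n - min m n)) +
      (∑ m ∈ range M, ∑ n ∈ range M, Real.sin (m * θ) * Real.sin (n * θ) * c (max m n - min m n)) := by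
    unfold fejerSum
    rw [← Finset.sum_add_distrib]
    refine Finset.sum_congr rfl fun m _ => ?_
    rw [← Finset.sum_add_distrib]
    refine Finset.sum_congr rfl fun n _ => ?_
    rw [cos_absdiff_mul]; ring
  rw [e]; exact add_nonneg h1 h2

/-- Continuity of the Fejér means. [folklore] -/
theorem continuous_fejerSum (c : ℕ → ℝ) (M : ℕ) : Continuous (fejerSum c M) := by
  unfold fejerSum; fun_prop

/-- **Double-sum to single-sum**: `Σ_{m,n<M} F(|m-n|) = M F(0) + 2 Σ_{1≤k<M} (M-k) F(k)`. [folklore] -/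
theorem sum_sum_absdiff {α : Type*} [CommRing α] (F : ℕ → α) (M : ℕ) :
    ∑ m ∈ range M, ∑ n ∈ range M, F (max m n - min m n) =
      (M : α) * F 0 + 2 * ∑ k ∈ Ico 1 M, ((M : α) - k) * F k := by
  induction M with
  | zero => simp
  | succ M ih =>
    rw [Finset.sum_range_succ]
    have hcol : ∀ m ∈ range M, ∑ n ∈ range (M + 1), F (max m n - min m n) =
        ∑ n ∈ range M, F (max m n - min m n) + F (M - m) := by
      intro m hm
      rw [Finset.sum_range_succ]
      have hm' : m ≤ M := (mem_range.1 hm).le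
      rw [max_eq_right hm', min_eq_left hm']
    rw [Finset.sum_congr rfl hcol, Finset.sum_add_distrib, ih]
    -- the new row `m = M`
    have hrow : ∑ n ∈ range (M + 1), F (max M n - min M n) = ∑ n ∈ range M, F (M - n) + F 0 := by
      rw [Finset.sum_range_succ, max_self, min_self, Nat.sub_self]
      congr 1
      refine Finset.sum_congr rfl fun n hn => ?_
      have hn' : n ≤ M := (mem_range.1 hn).le
      rw [max_eq_left hn', min_eq_right hn']
    rw [hrow]
    -- reindex `Σ_{m<M} F(M-m) = Σ_{k∈Ico 1 (M+1)} F k`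
    have hrefl : ∑ m ∈ range M, F (M - m) = ∑ k ∈ Ico 1 (M + 1), F k := by
      rw [Finset.range_eq_Ico, Finset.sum_Ico_reflect _ 0 (Nat.le_succ M)]
      · simp
    rw [hrefl]
    -- split the `Ico 1 (M+1)` sums at `M`
    have hsplit1 : ∑ k ∈ Ico 1 (M + 1), F k = ∑ k ∈ Ico 1 M, F k + (if 1 ≤ M then F M else 0) := by
      by_cases hM : 1 ≤ M
      · rw [Finset.sum_Ico_succ_top hM, if_pos hM]
      · push Not at hM
        interval_cases M; simp
    have hsplit2 : ∑ k ∈ Ico 1 (M + 1), (((M + 1 : ℕ) : α) - k) * F k =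
        ∑ k ∈ Ico 1 M, (((M + 1 : ℕ) : α) - k) * F k + (if 1 ≤ M then (((M + 1 : ℕ) : α) - M) * F M else 0) := by
      by_cases hM : 1 ≤ M
      · rw [Finset.sum_Ico_succ_top hM, if_pos hM]
      · push Not at hM
        interval_cases M; simp
    rw [hsplit1, hsplit2]
    have hdiff : ∑ k ∈ Ico 1 M, (((M + 1 : ℕ) : α) - k) * F k =
        ∑ k ∈ Ico 1 M, ((M : α) - k) * F k + ∑ k ∈ Ico 1 M, F k := by
      rw [← Finset.sum_add_distrib]
      refine Finset.sum_congr rfl fun k _ => ?_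
      push_cast; ring
    rw [hdiff]
    by_cases hM : 1 ≤ M
    · simp only [if_pos hM]; push_cast; ring
    · simp only [if_neg hM]; push_cast; ring

/-- The Fejér mean in cosine-polynomial form:
`F_M(θ) = M c_0 + 2 Σ_{1≤k<M} (M-k) c_k cos(kθ)`. [folklore] -/
theorem fejerSum_eq (c : ℕ → ℝ) (M : ℕ) (θ : ℝ) :
    fejerSum c M θ = (M : ℝ) * c 0 + 2 * ∑ k ∈ Ico 1 M, ((M : ℝ) - k) * (c k * Real.cos (k * θ)) := by
  have h := sum_sum_absdiff (fun k => c k * Real.cos ((k : ℝ) * θ)) M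
  simp only [Nat.cast_zero, zero_mul, Real.cos_zero, mul_one] at h
  exact h

/-! ### Orthogonality of cosines on `[-π, π]` -/

/-- `∫_{-π}^{π} cos(n θ) dθ = 0` for a nonzero integer `n`. [folklore] -/
theorem integral_cos_int_mul {n : ℤ} (hn : n ≠ 0) :
    ∫ θ in (-π)..π, Real.cos (n * θ) = 0 := by
  have hn' : (n : ℝ) ≠ 0 := Int.cast_ne_zero.mpr hn
  rw [intervalIntegral.integral_comp_mul_left (fun x => Real.cos x) hn', integral_cos, mul_neg, Real.sin_neg,
    Real.sin_int_mul_pi]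
  simp

/-- `∫_{-π}^{π} cos(n θ) dθ = 2π` for `n = 0` and `0` for a nonzero integer. [folklore] -/
theorem integral_cos_int_mul' (n : ℤ) :
    ∫ θ in (-π)..π, Real.cos (n * θ) = if n = 0 then 2 * π else 0 := by
  split_ifs with h
  · subst h; simp; ring
  · exact integral_cos_int_mul h

/-- Product-to-sum. [folklore] -/
theorem two_mul_cos_mul_cos (a b : ℝ) : 2 * (Real.cos a * Real.cos b) = Real.cos (a - b) + Real.cos (a + b) := by
  rw [Real.cos_sub, Real.cos_add]; ring

/-- Orthogonality: for naturals `k, j`, `∫_{-π}^{π} cos(kθ) cos(jθ) dθ` is `2π` if `k = j = 0`, `π` if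
`k = j ≥ 1`, and `0` otherwise. [folklore] -/
theorem integral_cos_mul_cos (k j : ℕ) :
    ∫ θ in (-π)..π, Real.cos (k * θ) * Real.cos (j * θ) =
      if k = j then (if k = 0 then 2 * π else π) else 0 := by
  have e : (fun θ : ℝ => Real.cos (k * θ) * Real.cos (j * θ)) =
      fun θ => (1/2 : ℝ) * (Real.cos (((k : ℤ) - j : ℤ) * θ) + Real.cos (((k : ℤ) + j : ℤ) * θ)) := by
    funext θ
    have := two_mul_cos_mul_cos (k * θ) (j * θ)
    push_cast
    rw [show ((k : ℝ) - j) * θ = k * θ - j * θ by ring, show ((k : ℝ) + j) * θ = k * θ + j * θ by ring]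
    linarith
  rw [e, intervalIntegral.integral_const_mul,
    intervalIntegral.integral_add (Continuous.intervalIntegrable (by fun_prop) _ _)
      (Continuous.intervalIntegrable (by fun_prop) _ _),
    integral_cos_int_mul', integral_cos_int_mul']
  by_cases hkj : k = j
  · subst hkj
    by_cases hk : k = 0
    · subst hk
      simp only [Nat.cast_zero, sub_self, add_zero, if_true]
      ring
    · have h2 : ((k : ℤ) + k : ℤ) ≠ 0 := by omega
      simp only [sub_self, if_true, h2, if_false, hk, add_zero]
      ring
  · have h1 : ((k : ℤ) - j : ℤ) ≠ 0 := by omega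
    have h2 : ((k : ℤ) + j : ℤ) ≠ 0 := by
      intro h; have : k = 0 ∧ j = 0 := by omega
      exact hkj (this.1.trans this.2.symm)
    simp [h1, h2, hkj]

/-! ### Moments of the Fejér means -/

/-- `∫_{-π}^{π} cos(kθ) F_M(θ) dθ = 2π (M - k)₊ c_k` (for `k < M`; `0` beyond). [folklore] -/
theorem integral_cos_mul_fejerSum (c : ℕ → ℝ) (M k : ℕ) :
    ∫ θ in (-π)..π, Real.cos (k * θ) * fejerSum c M θ =
      2 * π * (if k < M then ((M : ℝ) - k) * c k else 0) := by
  simp_rw [fejerSum_eq, mul_add, Finset.mul_sum]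
  rw [intervalIntegral.integral_add (Continuous.intervalIntegrable (by fun_prop) _ _)
      (Continuous.intervalIntegrable (by fun_prop) _ _)]
  rw [intervalIntegral.integral_finsetSum (fun i _ => Continuous.intervalIntegrable (by fun_prop) _ _)]
  -- first term: `M c_0 ∫ cos(kθ)`
  have t1 : ∫ θ in (-π)..π, Real.cos (k * θ) * ((M : ℝ) * c 0) = (if k = 0 then 2 * π else 0) * ((M : ℝ) * c 0) := by
    rw [intervalIntegral.integral_mul_const]
    congr 1
    have := integral_cos_int_mul' (k : ℤ)
    push_cast at this
    rw [this]
    simp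
  -- generic term
  have t2 : ∀ i ∈ Ico 1 M, ∫ θ in (-π)..π, Real.cos (k * θ) * (2 * (((M : ℝ) - i) * (c i * Real.cos (i * θ)))) =
      2 * ((M : ℝ) - i) * c i * (if k = i then π else 0) := by
    intro i hi
    have hi1 : 1 ≤ i := (mem_Ico.1 hi).1
    have e : (fun θ => Real.cos (k * θ) * (2 * (((M : ℝ) - i) * (c i * Real.cos (i * θ))))) =
        fun θ => (2 * ((M : ℝ) - i) * c i) * (Real.cos (k * θ) * Real.cos (i * θ)) := by
      funext θ; ring
    rw [e, intervalIntegral.integral_const_mul, integral_cos_mul_cos]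
    by_cases hki : k = i
    · subst hki
      have : k ≠ 0 := by omega
      simp [this]
    · simp [hki]
  rw [t1, Finset.sum_congr rfl t2]
  by_cases hk : k = 0
  · subst hk
    have hz : ∀ i ∈ Ico 1 M, 2 * ((M : ℝ) - i) * c i * (if (0 : ℕ) = i then π else 0) = 0 := by
      intro i hi
      have : (0 : ℕ) ≠ i := by have := (mem_Ico.1 hi).1; omega
      simp [this]
    rw [Finset.sum_congr rfl hz, Finset.sum_const_zero, add_zero]
    by_cases hM : 0 < M
    · simp [hM]
    · have : M = 0 := by omega
      subst this; simp
  · simp only [hk, if_false, zero_mul, zero_add]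
    by_cases hkM : k < M
    · have hmem : k ∈ Ico 1 M := mem_Ico.2 ⟨Nat.one_le_iff_ne_zero.2 hk, hkM⟩
      rw [← Finset.add_sum_erase _ _ hmem]
      have hz : ∀ i ∈ (Ico 1 M).erase k, 2 * ((M : ℝ) - i) * c i * (if k = i then π else 0) = 0 := by
        intro i hi
        have : k ≠ i := fun h => (mem_erase.1 hi).1 h.symm
        simp [this]
      rw [Finset.sum_congr rfl hz, Finset.sum_const_zero, add_zero, if_pos rfl, if_pos hkM]
      ring
    · rw [if_neg hkM]
      have hz : ∀ i ∈ Ico 1 M, 2 * ((M : ℝ) - i) * c i * (if k = i then π else 0) = 0 := by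
        intro i hi
        have : k ≠ i := by have := (mem_Ico.1 hi).2; omega
        simp [this]
      rw [Finset.sum_congr rfl hz, Finset.sum_const_zero, mul_zero]


/-! ### The Fejér measures -/

/-- The Fejér measure `ρ_M = F_M(θ) dθ / (2πM)` on `[-π, π]` (as a measure on `ℝ`). [folklore] -/
def fejerMeasure (c : ℕ → ℝ) (M : ℕ) : Measure ℝ :=
  (volume.restrict (Set.Icc (-π) π)).withDensity
    (fun θ => ENNReal.ofReal (fejerSum c M θ / (2 * π * M)))

/-- `fejerDensity_nonneg` (line `cayley-pencil`, stub `stub_stieltjesOfPencil` support). [folklore] -/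
theorem fejerDensity_nonneg {c : ℕ → ℝ} (hc : IsToeplitzPSD c) (M : ℕ) (θ : ℝ) :
    0 ≤ fejerSum c M θ / (2 * π * M) := by
  rcases Nat.eq_zero_or_pos M with rfl | hM
  · simp
  · exact div_nonneg (fejerSum_nonneg hc M θ) (by positivity)

/-- `measurable_fejerDensity` (line `cayley-pencil`, stub `stub_stieltjesOfPencil` support). [folklore] -/
theorem measurable_fejerDensity (c : ℕ → ℝ) (M : ℕ) :
    Measurable fun θ : ℝ => ENNReal.ofReal (fejerSum c M θ / (2 * π * M)) :=
  ((continuous_fejerSum c M).div_const _).measurable.ennreal_ofReal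

/-- Integration against the Fejér measure is an interval integral against the density. [folklore] -/
theorem integral_fejerMeasure {c : ℕ → ℝ} (hc : IsToeplitzPSD c) (M : ℕ) {g : ℝ → ℝ} (_hg : Continuous g) :
    ∫ θ, g θ ∂(fejerMeasure c M) = ∫ θ in (-π)..π, g θ * (fejerSum c M θ / (2 * π * M)) := by
  unfold fejerMeasure
  rw [integral_withDensity_eq_integral_toReal_smul (measurable_fejerDensity c M)
    (Eventually.of_forall fun _ => ENNReal.ofReal_lt_top)]
  have e : (fun θ : ℝ => (ENNReal.ofReal (fejerSum c M θ / (2 * π * M))).toReal • g θ) =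
      fun θ => g θ * (fejerSum c M θ / (2 * π * M)) := by
    funext θ
    rw [ENNReal.toReal_ofReal (fejerDensity_nonneg hc M θ), smul_eq_mul, mul_comm]
  rw [e, integral_Icc_eq_integral_Ioc, ← intervalIntegral.integral_of_le (by linarith [Real.pi_pos])]

/-- Moments of the Fejér measure: `∫ cos(kθ) dρ_M = (1 - k/M) c_k` for `k < M`, `0` otherwise. [folklore] -/
theorem integral_cos_fejerMeasure {c : ℕ → ℝ} (hc : IsToeplitzPSD c) {M : ℕ} (hM : 0 < M) (k : ℕ) :
    ∫ θ, Real.cos (k * θ) ∂(fejerMeasure c M) = if k < M then (1 - (k : ℝ) / M) * c k else 0 := by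
  rw [integral_fejerMeasure hc M (by fun_prop)]
  have e : (fun θ : ℝ => Real.cos (k * θ) * (fejerSum c M θ / (2 * π * M))) =
      fun θ => (1 / (2 * π * M)) * (Real.cos (k * θ) * fejerSum c M θ) := by
    funext θ; ring
  rw [e, intervalIntegral.integral_const_mul, integral_cos_mul_fejerSum]
  have hM' : (0 : ℝ) < M := by exact_mod_cast hM
  have hπ := Real.pi_pos
  split_ifs with hk
  · field_simp
  · simp

/-- The Fejér measure lives on `[-π, π]`. [folklore] -/
theorem fejerMeasure_compl_Icc (c : ℕ → ℝ) (M : ℕ) : fejerMeasure c M (Set.Icc (-π) π)ᶜ = 0 := by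
  unfold fejerMeasure
  rw [withDensity_apply _ (measurableSet_Icc.compl), Measure.restrict_restrict (measurableSet_Icc.compl),
    Set.compl_inter_self, Measure.restrict_empty, lintegral_zero_measure]

/-- Total mass `c_0`. [folklore] -/
theorem fejerMeasure_univ {c : ℕ → ℝ} (hc : IsToeplitzPSD c) {M : ℕ} (hM : 0 < M) :
    fejerMeasure c M Set.univ = ENNReal.ofReal (c 0) := by
  have hint : Integrable (fun θ : ℝ => fejerSum c M θ / (2 * π * M)) (volume.restrict (Set.Icc (-π) π)) :=
    ((continuous_fejerSum c M).div_const _).continuousOn.integrableOn_compact isCompact_Icc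
  unfold fejerMeasure
  rw [withDensity_apply _ MeasurableSet.univ, Measure.restrict_univ,
    ← ofReal_integral_eq_lintegral_ofReal hint (Eventually.of_forall fun θ => fejerDensity_nonneg hc M θ)]
  congr 1
  have h := integral_cos_fejerMeasure hc hM 0
  rw [integral_fejerMeasure hc M (by fun_prop)] at h
  simp only [Nat.cast_zero, zero_mul, Real.cos_zero, one_mul, hM, if_true, zero_div, sub_zero] at h
  rw [integral_Icc_eq_integral_Ioc, ← intervalIntegral.integral_of_le (by linarith [Real.pi_pos])]
  exact h

/-- `isFiniteMeasure_fejerMeasure` (line `cayley-pencil`, stub `stub_stieltjesOfPencil` support). [folklore] -/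
instance isFiniteMeasure_fejerMeasure (c : ℕ → ℝ) (M : ℕ) : IsFiniteMeasure (fejerMeasure c M) := by
  refine ⟨?_⟩
  unfold fejerMeasure
  rw [withDensity_apply _ MeasurableSet.univ, Measure.restrict_univ]
  have hint : Integrable (fun θ : ℝ => fejerSum c M θ / (2 * π * M)) (volume.restrict (Set.Icc (-π) π)) :=
    ((continuous_fejerSum c M).div_const _).continuousOn.integrableOn_compact isCompact_Icc
  calc ∫⁻ a in Set.Icc (-π) π, ENNReal.ofReal (fejerSum c M a / (2 * π * M))
      ≤ ∫⁻ a in Set.Icc (-π) π, ‖fejerSum c M a / (2 * π * M)‖ₑ :=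
        lintegral_mono fun θ => Real.ofReal_le_enorm _
    _ < ⊤ := hint.2

/-! ### Herglotz: extraction of the limit measure -/

/-- The bounded continuous function `cos(k ·)`. [folklore] -/
def cosBCF (k : ℕ) : BoundedContinuousFunction ℝ ℝ :=
  BoundedContinuousFunction.mkOfBound ⟨fun θ => Real.cos (k * θ), by fun_prop⟩ 2 (by
    intro x y
    rw [Real.dist_eq]
    have h1 := Real.abs_cos_le_one (k * x)
    have h2 := Real.abs_cos_le_one (k * y)
    calc |Real.cos (k * x) - Real.cos (k * y)| ≤ |Real.cos (k * x)| + |Real.cos (k * y)| := abs_sub _ _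
      _ ≤ 2 := by linarith)

/-- `cosBCF_apply` (line `cayley-pencil`, stub `stub_stieltjesOfPencil` support). [folklore] -/
theorem cosBCF_apply (k : ℕ) (θ : ℝ) : cosBCF k θ = Real.cos (k * θ) := rfl

/-- **Herglotz's theorem for positive-definite real sequences.** [folklore] -/
theorem exists_measure_of_isToeplitzPSD {c : ℕ → ℝ} (hc : IsToeplitzPSD c) :
    ∃ ρ : Measure ℝ, IsFiniteMeasure ρ ∧ ρ Set.univ = ENNReal.ofReal (c 0) ∧
      ∀ k : ℕ, ∫ θ, Real.cos (k * θ) ∂ρ = c k := by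
  rcases (hc.zero_nonneg).eq_or_lt with h0 | h0
  · -- `c 0 = 0`: everything vanishes
    refine ⟨0, inferInstance, by simp [← h0], fun k => ?_⟩
    have := hc.abs_le k
    rw [← h0] at this
    have hk : c k = 0 := abs_nonpos_iff.mp this
    simp [hk]
  -- `c 0 > 0`: normalise the Fejér measures to probability measures
  have hc0 : ENNReal.ofReal (c 0) ≠ 0 := by simpa using h0
  have hc0' : ENNReal.ofReal (c 0) ≠ ⊤ := ENNReal.ofReal_ne_top
  let μM : ℕ → Measure ℝ := fun M => (ENNReal.ofReal (c 0))⁻¹ • fejerMeasure c (M + 1)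
  have hprob : ∀ M, IsProbabilityMeasure (μM M) := by
    intro M
    refine ⟨?_⟩
    simp only [μM, Measure.smul_apply, smul_eq_mul]
    rw [fejerMeasure_univ hc (Nat.succ_pos M), ENNReal.inv_mul_cancel hc0 hc0']
  let μP : ℕ → ProbabilityMeasure ℝ := fun M => ⟨μM M, hprob M⟩
  have hμP : ∀ M, ((μP M : ProbabilityMeasure ℝ) : Measure ℝ) = μM M := fun M => rfl
  -- moments of the normalised measures
  have hmom : ∀ (k M : ℕ), ∫ θ, Real.cos (k * θ) ∂(μP M : Measure ℝ) =
      (c 0)⁻¹ * (if k < M + 1 then (1 - (k : ℝ) / (M + 1 : ℕ)) * c k else 0) := by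
    intro k M
    rw [hμP, integral_smul_measure, integral_cos_fejerMeasure hc (Nat.succ_pos M) k,
      ENNReal.toReal_inv, ENNReal.toReal_ofReal h0.le, smul_eq_mul]
  -- tightness: everything lives on `[-π, π]`
  have htight : IsTightMeasureSet {((μ : ProbabilityMeasure ℝ) : Measure ℝ) | μ ∈ Set.range μP} := by
    rw [isTightMeasureSet_iff_exists_isCompact_measure_compl_le]
    intro ε hε
    refine ⟨Set.Icc (-π) π, isCompact_Icc, fun μ hμ => ?_⟩
    obtain ⟨ν, ⟨M, rfl⟩, rfl⟩ := hμ
    rw [hμP]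
    simp only [μM, Measure.smul_apply, smul_eq_mul, fejerMeasure_compl_Icc, mul_zero]
    exact zero_le
  have hcomp : IsCompact (closure (Set.range μP)) := isCompact_closure_of_isTightMeasureSet htight
  obtain ⟨ν, -, φ, hφ, hconv⟩ :=
    hcomp.tendsto_subseq (fun n => subset_closure (Set.mem_range_self n))
  -- moments pass to the limit
  have hlim : ∀ k : ℕ, ∫ θ, Real.cos (k * θ) ∂(ν : Measure ℝ) = (c 0)⁻¹ * c k := by
    intro k
    have h1 := (ProbabilityMeasure.tendsto_iff_forall_integral_tendsto.1 hconv) (cosBCF k)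
    simp only [Function.comp_apply, cosBCF_apply] at h1
    -- the explicit moments converge to `(c 0)⁻¹ c k`
    have h2 : Tendsto (fun i => ∫ θ, Real.cos (k * θ) ∂(μP (φ i) : Measure ℝ)) atTop
        (𝓝 ((c 0)⁻¹ * c k)) := by
      simp_rw [hmom]
      have hφ' : Tendsto φ atTop atTop := hφ.tendsto_atTop
      have hev : ∀ᶠ i in atTop, (c 0)⁻¹ * (if k < φ i + 1 then (1 - (k : ℝ) / (φ i + 1 : ℕ)) * c k else 0) =
          (c 0)⁻¹ * ((1 - (k : ℝ) / (φ i + 1 : ℕ)) * c k) := by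
        filter_upwards [hφ'.eventually_ge_atTop k] with i hi
        rw [if_pos (by omega)]
      refine Tendsto.congr' (EventuallyEq.symm hev) ?_
      have h3 : Tendsto (fun i => (k : ℝ) / (φ i + 1 : ℕ)) atTop (𝓝 0) := by
        have : Tendsto (fun i => ((φ i + 1 : ℕ) : ℝ)) atTop atTop := by
          exact tendsto_natCast_atTop_atTop.comp (tendsto_add_atTop_nat 1 |>.comp hφ')
        exact tendsto_const_nhds.div_atTop this
      have h4 : Tendsto (fun i => (c 0)⁻¹ * ((1 - (k : ℝ) / (φ i + 1 : ℕ)) * c k)) atTop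
          (𝓝 ((c 0)⁻¹ * ((1 - 0) * c k))) :=
        ((tendsto_const_nhds.sub h3).mul tendsto_const_nhds).const_mul _
      simpa using h4
    exact tendsto_nhds_unique h1 h2
  -- the limit measure, rescaled by `c 0`
  refine ⟨ENNReal.ofReal (c 0) • (ν : Measure ℝ), ⟨?_⟩, ?_, fun k => ?_⟩
  · rw [Measure.smul_apply, smul_eq_mul, measure_univ, mul_one]; exact ENNReal.ofReal_lt_top
  · rw [Measure.smul_apply, smul_eq_mul, measure_univ, mul_one]
  · rw [integral_smul_measure, hlim k, ENNReal.toReal_ofReal h0.le, smul_eq_mul, ← mul_assoc,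
      mul_inv_cancel₀ h0.ne', one_mul]

end CayleyPencilHerglotz

end

/-!
# Stage C: from the Cayley moments to the Stieltjes representation (`stub_stieltjesOfPencil`)
-/

noncomputable section

open scoped BigOperators Real Topology ENNReal RealInnerProductSpace
open Finset MeasureTheory Filter

namespace CayleyPencilStieltjes

open CayleyPencilAlgebra CayleyPencilHerglotz

variable {K : Type*} [NormedAddCommGroup K] [InnerProductSpace ℝ K] {W : ℝ → K →L[ℝ] K}

/-! ### The Cayley moment sequence -/

/-- `c_k = ⟪C^k g, g⟫`. [folklore] -/
def momentSeq (W : ℝ → K →L[ℝ] K) (g : K) (k : ℕ) : ℝ := inner ℝ ((cayley W ^ k) g) g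

/-- `isToeplitzPSD_momentSeq` (line `cayley-pencil`, stub `stub_stieltjesOfPencil` support). [folklore] -/
theorem isToeplitzPSD_momentSeq (hW : IsDissipativePencil W) (g : K) : IsToeplitzPSD (momentSeq W g) :=
  fun a M => toeplitz_nonneg hW g a M

/-- `momentSeq_zero` (line `cayley-pencil`, stub `stub_stieltjesOfPencil` support). [folklore] -/
theorem momentSeq_zero (g : K) : momentSeq W g 0 = ‖g‖ ^ 2 := by
  simp [momentSeq]

/-- `abs_momentSeq_le` (line `cayley-pencil`, stub `stub_stieltjesOfPencil` support). [folklore] -/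
theorem abs_momentSeq_le (hW : IsDissipativePencil W) (g : K) (k : ℕ) : |momentSeq W g k| ≤ ‖g‖ ^ 2 := by
  rw [← momentSeq_zero (W := W) g]; exact (isToeplitzPSD_momentSeq hW g).abs_le k

/-- `⟪g, S_n g + C (S_n g)⟫ = Σ_{k<n} (-q)^k (c_k + c_{k+1})`. [folklore] -/
theorem inner_partialSum (g : K) (q : ℝ) (n : ℕ) :
    inner ℝ g (partialSum W q n g + cayley W (partialSum W q n g)) =
      ∑ k ∈ range n, (-q) ^ k * (momentSeq W g k + momentSeq W g (k + 1)) := by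
  unfold partialSum momentSeq
  rw [map_sum, inner_add_right, inner_sum, inner_sum, ← Finset.sum_add_distrib]
  refine Finset.sum_congr rfl fun k _ => ?_
  rw [map_smul, real_inner_smul_right, real_inner_smul_right, ← pow_succ_apply,
    real_inner_comm ((cayley W ^ k) g), real_inner_comm ((cayley W ^ (k + 1)) g)]
  ring

/-- **Scalar resummation**: `Σ_k (-q)^k (c_k + c_{k+1}) = (γ+1) ⟪g, W γ g⟫`, `q = (γ-1)/(γ+1)`. [folklore] -/
theorem hasSum_momentSeq (hW : IsDissipativePencil W) {γ : ℝ} (hγ : 0 < γ) (g : K) :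
    HasSum (fun k => (-((γ - 1) / (γ + 1))) ^ k * (momentSeq W g k + momentSeq W g (k + 1)))
      ((γ + 1) * inner ℝ g (W γ g)) := by
  set q : ℝ := (γ - 1) / (γ + 1) with hq
  have hq1 : |q| < 1 := abs_ratio_lt_one hγ
  -- summability by comparison with a geometric series
  have hsum : Summable (fun k => (-q) ^ k * (momentSeq W g k + momentSeq W g (k + 1))) := by
    refine Summable.of_norm_bounded (g := fun k => |q| ^ k * (2 * ‖g‖ ^ 2))
      ((summable_geometric_of_lt_one (abs_nonneg q) hq1).mul_right _) (fun k => ?_)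
    rw [Real.norm_eq_abs, abs_mul, abs_pow, abs_neg]
    refine mul_le_mul_of_nonneg_left ?_ (pow_nonneg (abs_nonneg q) k)
    have h1 := abs_momentSeq_le hW g k
    have h2 := abs_momentSeq_le hW g (k + 1)
    calc |momentSeq W g k + momentSeq W g (k + 1)| ≤ |momentSeq W g k| + |momentSeq W g (k + 1)| :=
          abs_add_le _ _
      _ ≤ 2 * ‖g‖ ^ 2 := by linarith
  rw [hsum.hasSum_iff_tendsto_nat]
  -- partial sums = `(γ+1)(⟪g, W γ g⟫ - ⟪g, W γ r_n⟫)`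
  have hpart : ∀ n : ℕ, ∑ k ∈ range n, (-q) ^ k * (momentSeq W g k + momentSeq W g (k + 1)) =
      (γ + 1) * inner ℝ g (W γ g) -
        (γ + 1) * inner ℝ g (W γ ((-q) ^ n • (cayley W ^ n) g)) := by
    intro n
    rw [← inner_partialSum, ← resum hW hγ n g, real_inner_smul_right, map_sub, inner_sub_right, mul_sub]
  simp_rw [hpart]
  have h0 : Tendsto (fun n : ℕ => (γ + 1) * inner ℝ g (W γ ((-q) ^ n • (cayley W ^ n) g))) atTop (𝓝 0) := by
    have h := (tendsto_remainder hW hγ g)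
    have h' : Tendsto (fun n : ℕ => inner ℝ g (W γ ((-q) ^ n • (cayley W ^ n) g))) atTop (𝓝 (inner ℝ g (0:K))) :=
      (continuous_inner.comp (continuous_const.prodMk continuous_id)).continuousAt.tendsto.comp h
    rw [inner_zero_right] at h'
    simpa using h'.const_mul (γ + 1)
  have := (tendsto_const_nhds (x := (γ + 1) * inner ℝ g (W γ g))).sub h0
  rw [sub_zero] at this
  exact this

/-! ### The Poisson-type closed form -/

/-- The integrand `K_γ(θ) = γ (1 + cos θ) / (γ² (1 + cos θ) + (1 - cos θ))` ( `= γ/(γ² + tan²(θ/2))` ). [folklore] -/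
def poissonFn (γ θ : ℝ) : ℝ :=
  γ * (1 + Real.cos θ) / (γ ^ 2 * (1 + Real.cos θ) + (1 - Real.cos θ))

/-- `poissonFn_den_pos` (line `cayley-pencil`, stub `stub_stieltjesOfPencil` support). [folklore] -/
theorem poissonFn_den_pos {γ : ℝ} (hγ : 0 < γ) (θ : ℝ) :
    0 < γ ^ 2 * (1 + Real.cos θ) + (1 - Real.cos θ) := by
  have h1 : -1 ≤ Real.cos θ := Real.neg_one_le_cos θ
  have h2 : Real.cos θ ≤ 1 := Real.cos_le_one θ
  rcases h1.eq_or_lt with h | h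
  · rw [← h]; norm_num
  · have : 0 < 1 + Real.cos θ := by linarith
    positivity

/-- `poissonFn_nonneg` (line `cayley-pencil`, stub `stub_stieltjesOfPencil` support). [folklore] -/
theorem poissonFn_nonneg {γ : ℝ} (hγ : 0 < γ) (θ : ℝ) : 0 ≤ poissonFn γ θ := by
  unfold poissonFn
  refine div_nonneg (mul_nonneg hγ.le ?_) (poissonFn_den_pos hγ θ).le
  linarith [Real.neg_one_le_cos θ]

/-- `poissonFn_le` (line `cayley-pencil`, stub `stub_stieltjesOfPencil` support). [folklore] -/
theorem poissonFn_le {γ : ℝ} (hγ : 0 < γ) (θ : ℝ) : poissonFn γ θ ≤ γ⁻¹ := by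
  unfold poissonFn
  rw [div_le_iff₀ (poissonFn_den_pos hγ θ)]
  have h1 : 0 ≤ 1 + Real.cos θ := by linarith [Real.neg_one_le_cos θ]
  have h2 : 0 ≤ 1 - Real.cos θ := by linarith [Real.cos_le_one θ]
  have e : γ⁻¹ * (γ ^ 2 * (1 + Real.cos θ) + (1 - Real.cos θ)) =
      γ * (1 + Real.cos θ) + γ⁻¹ * (1 - Real.cos θ) := by field_simp
  rw [e]
  have : 0 ≤ γ⁻¹ * (1 - Real.cos θ) := mul_nonneg (inv_nonneg.2 hγ.le) h2
  linarith

/-- `continuous_poissonFn` (line `cayley-pencil`, stub `stub_stieltjesOfPencil` support). [folklore] -/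
theorem continuous_poissonFn {γ : ℝ} (hγ : 0 < γ) : Continuous (poissonFn γ) := by
  unfold poissonFn
  exact Continuous.div (by fun_prop) (by fun_prop) fun θ => (poissonFn_den_pos hγ θ).ne'

/-- **Poisson resummation**: `Σ_k (-q)^k (cos kθ + cos (k+1)θ) = (γ+1) K_γ(θ)`, `q = (γ-1)/(γ+1)`. [folklore] -/
theorem hasSum_cos_geometric {γ : ℝ} (hγ : 0 < γ) (θ : ℝ) :
    HasSum (fun k : ℕ => (-((γ - 1) / (γ + 1))) ^ k * (Real.cos (k * θ) + Real.cos ((k + 1 : ℕ) * θ)))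
      ((γ + 1) * poissonFn γ θ) := by
  set q : ℝ := (γ - 1) / (γ + 1) with hq
  clear_value q
  have hq1 : |q| < 1 := by rw [hq]; exact abs_ratio_lt_one hγ
  have hγ1 : (γ + 1) ≠ 0 := by linarith
  -- complex geometric series with ratio `z = -q e^{iθ}`
  set e : ℂ := Complex.exp (θ * Complex.I) with he
  set z : ℂ := (-q : ℝ) * e with hz
  have hz1 : ‖z‖ < 1 := by
    rw [hz, norm_mul, Complex.norm_real, he, Complex.norm_exp_ofReal_mul_I, mul_one, Real.norm_eq_abs,
      abs_neg]
    exact hq1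
  have hgeo := hasSum_geometric_of_norm_lt_one hz1
  have hmul : HasSum (fun n : ℕ => (1 + e) * z ^ n) ((1 + e) * (1 - z)⁻¹) := hgeo.mul_left (1 + e)
  have hre := Complex.reCLM.hasSum hmul
  simp only [Complex.reCLM_apply] at hre
  -- identify the terms
  have hterm : ∀ n : ℕ, ((1 + e) * z ^ n).re = (-q) ^ n * (Real.cos (n * θ) + Real.cos ((n + 1 : ℕ) * θ)) := by
    intro n
    have hzn : z ^ n = ((-q) ^ n : ℝ) * Complex.exp ((n * θ : ℝ) * Complex.I) := by
      rw [hz, mul_pow, he, ← Complex.exp_nat_mul]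
      push_cast; ring_nf
    have h2 : (1 + e) * z ^ n = ((-q) ^ n : ℝ) * (Complex.exp ((n * θ : ℝ) * Complex.I) +
        Complex.exp ((((n + 1 : ℕ) : ℝ) * θ : ℝ) * Complex.I)) := by
      rw [hzn, he, mul_add, add_mul, one_mul]
      congr 1
      rw [mul_left_comm, ← Complex.exp_add]
      congr 2
      push_cast; ring
    rw [h2, Complex.re_ofReal_mul, Complex.add_re, Complex.exp_ofReal_mul_I_re, Complex.exp_ofReal_mul_I_re]
  -- identify the sum
  have hval : ((1 + e) * (1 - z)⁻¹).re = (γ + 1) * poissonFn γ θ := by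
    have hden := poissonFn_den_pos hγ θ
    have e_re : e.re = Real.cos θ := by rw [he, Complex.exp_ofReal_mul_I_re]
    have e_im : e.im = Real.sin θ := by rw [he, Complex.exp_ofReal_mul_I_im]
    have d_re : (1 - z).re = 1 + q * Real.cos θ := by
      rw [Complex.sub_re, hz, Complex.re_ofReal_mul, e_re, Complex.one_re]; ring
    have d_im : (1 - z).im = q * Real.sin θ := by
      rw [Complex.sub_im, hz, Complex.im_ofReal_mul, e_im, Complex.one_im]; ring
    have hs2 : Real.sin θ * Real.sin θ = 1 - Real.cos θ ^ 2 := by rw [← sq, Real.sin_sq]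
    have hnormSq : Complex.normSq (1 - z) = 1 + 2 * q * Real.cos θ + q ^ 2 := by
      rw [Complex.normSq_apply, d_re, d_im]
      linear_combination (q ^ 2) * hs2
    have hN : 1 + 2 * q * Real.cos θ + q ^ 2 = 2 * (γ ^ 2 * (1 + Real.cos θ) + (1 - Real.cos θ)) / (γ + 1) ^ 2 := by
      rw [hq]; field_simp; ring
    have hNpos : 0 < 1 + 2 * q * Real.cos θ + q ^ 2 := by rw [hN]; positivity
    rw [Complex.mul_re, Complex.inv_re, Complex.inv_im, Complex.add_re, Complex.add_im, Complex.one_re,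
      Complex.one_im, e_re, e_im, zero_add, d_re, d_im, hnormSq]
    have step : (1 + Real.cos θ) * ((1 + q * Real.cos θ) / (1 + 2 * q * Real.cos θ + q ^ 2)) -
        Real.sin θ * (-(q * Real.sin θ) / (1 + 2 * q * Real.cos θ + q ^ 2)) =
        ((1 + q) * (1 + Real.cos θ)) / (1 + 2 * q * Real.cos θ + q ^ 2) := by
      rw [mul_div_assoc', mul_div_assoc', ← sub_div]
      congr 1
      linear_combination q * hs2
    rw [step, hN]
    unfold poissonFn
    rw [hq]
    field_simp
    ring
  have hfun : (fun n : ℕ => ((1 + e) * z ^ n).re) =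
      fun k : ℕ => (-q) ^ k * (Real.cos (k * θ) + Real.cos ((k + 1 : ℕ) * θ)) := funext hterm
  rw [hfun, hval] at hre
  exact hre


/-! ### Integration of the resummation against the Herglotz measure -/

/-- `integrable_of_continuous_bounded` (line `cayley-pencil`, stub `stub_stieltjesOfPencil` support). [folklore] -/
theorem integrable_of_continuous_bounded {ρ : Measure ℝ} [IsFiniteMeasure ρ] {f : ℝ → ℝ}
    (hf : Continuous f) {C : ℝ} (hC : ∀ x, ‖f x‖ ≤ C) : Integrable f ρ :=
  (integrable_const C).mono' hf.aestronglyMeasurable (Eventually.of_forall hC)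

/-- `⟪g, W γ g⟫ = ∫ K_γ dρ` for any finite measure `ρ` with the Cayley moments. [folklore] -/
theorem inner_eq_integral_poissonFn (hW : IsDissipativePencil W) {γ : ℝ} (hγ : 0 < γ) (g : K)
    {ρ : Measure ℝ} [IsFiniteMeasure ρ] (hmom : ∀ k : ℕ, ∫ θ, Real.cos (k * θ) ∂ρ = momentSeq W g k) :
    inner ℝ g (W γ g) = ∫ θ, poissonFn γ θ ∂ρ := by
  set q : ℝ := (γ - 1) / (γ + 1) with hq
  have hq1 : |q| < 1 := abs_ratio_lt_one hγ
  have hq1' : 0 < 1 - |q| := by linarith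
  -- partial sums of the Poisson resummation
  set P : ℕ → ℝ → ℝ := fun n θ =>
    ∑ k ∈ range n, (-q) ^ k * (Real.cos (k * θ) + Real.cos ((k + 1 : ℕ) * θ)) with hP
  have hPcont : ∀ n, Continuous (P n) := fun n => by rw [hP]; fun_prop
  have hPbound : ∀ n θ, ‖P n θ‖ ≤ 2 / (1 - |q|) := by
    intro n θ
    rw [Real.norm_eq_abs, hP]
    calc |∑ k ∈ range n, (-q) ^ k * (Real.cos (k * θ) + Real.cos ((k + 1 : ℕ) * θ))|
        ≤ ∑ k ∈ range n, |(-q) ^ k * (Real.cos (k * θ) + Real.cos ((k + 1 : ℕ) * θ))| :=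
          Finset.abs_sum_le_sum_abs _ _
      _ ≤ ∑ k ∈ range n, |q| ^ k * 2 := by
          refine Finset.sum_le_sum fun k _ => ?_
          rw [abs_mul, abs_pow, abs_neg]
          refine mul_le_mul_of_nonneg_left ?_ (pow_nonneg (abs_nonneg q) k)
          have h1 := Real.abs_cos_le_one (k * θ)
          have h2 := Real.abs_cos_le_one ((k + 1 : ℕ) * θ)
          calc |Real.cos (k * θ) + Real.cos ((k + 1 : ℕ) * θ)|
              ≤ |Real.cos (k * θ)| + |Real.cos ((k + 1 : ℕ) * θ)| := abs_add_le _ _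
            _ ≤ 2 := by linarith
      _ = (∑ k ∈ range n, |q| ^ k) * 2 := by rw [Finset.sum_mul]
      _ ≤ (1 - |q|)⁻¹ * 2 := by
          refine mul_le_mul_of_nonneg_right ?_ (by norm_num)
          have := geom_sum_Ico_le_of_lt_one (abs_nonneg q) hq1 (m := 0) (n := n)
          rw [pow_zero, ← Finset.range_eq_Ico] at this
          simpa [div_eq_inv_mul] using this
      _ = 2 / (1 - |q|) := by rw [div_eq_inv_mul]
  have hPint : ∀ n, ∫ θ, P n θ ∂ρ = ∑ k ∈ range n, (-q) ^ k * (momentSeq W g k + momentSeq W g (k + 1)) := by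
    intro n
    rw [hP]
    simp only
    rw [integral_finsetSum _ (fun k _ => ?_)]
    · refine Finset.sum_congr rfl fun k _ => ?_
      rw [integral_const_mul, integral_add, hmom k, hmom (k + 1)]
      · exact integrable_of_continuous_bounded (by fun_prop) (C := 1)
          (fun x => by simpa using Real.abs_cos_le_one _)
      · exact integrable_of_continuous_bounded (by fun_prop) (C := 1)
          (fun x => by simpa using Real.abs_cos_le_one _)
    · refine (Integrable.add ?_ ?_).const_mul _
      · exact integrable_of_continuous_bounded (by fun_prop) (C := 1)
          (fun x => by simpa using Real.abs_cos_le_one _)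
      · exact integrable_of_continuous_bounded (by fun_prop) (C := 1)
          (fun x => by simpa using Real.abs_cos_le_one _)
  have hPlim : ∀ θ, Tendsto (fun n => P n θ) atTop (𝓝 ((γ + 1) * poissonFn γ θ)) := fun θ => by
    rw [hP]; exact (hasSum_cos_geometric hγ θ).tendsto_sum_nat
  have hDCT : Tendsto (fun n => ∫ θ, P n θ ∂ρ) atTop (𝓝 (∫ θ, (γ + 1) * poissonFn γ θ ∂ρ)) :=
    tendsto_integral_of_dominated_convergence (fun _ => 2 / (1 - |q|))
      (fun n => (hPcont n).aestronglyMeasurable) (integrable_const _)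
      (fun n => Eventually.of_forall (hPbound n)) (Eventually.of_forall hPlim)
  have hser : Tendsto (fun n => ∫ θ, P n θ ∂ρ) atTop (𝓝 ((γ + 1) * inner ℝ g (W γ g))) := by
    simp_rw [hPint]
    exact (hasSum_momentSeq hW hγ g).tendsto_sum_nat
  have huniq := tendsto_nhds_unique hser hDCT
  rw [integral_const_mul] at huniq
  have hγ1 : (γ + 1) ≠ 0 := by linarith
  exact mul_left_cancel₀ hγ1 huniq

/-! ### The layer cake -/

/-- The Cauchy–Stieltjes weight `w_γ(t) = 2t/(γ²+t²)²` is the derivative of `-(γ²+t²)⁻¹`. [folklore] -/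
theorem hasDerivAt_neg_inv {γ : ℝ} (hγ : 0 < γ) (t : ℝ) :
    HasDerivAt (fun t : ℝ => -(γ ^ 2 + t ^ 2)⁻¹) (2 * t / (γ ^ 2 + t ^ 2) ^ 2) t := by
  have hc : HasDerivAt (fun t : ℝ => γ ^ 2 + t ^ 2) (2 * t) t := by
    simpa using ((hasDerivAt_pow 2 t).const_add (γ ^ 2))
  have hne : γ ^ 2 + t ^ 2 ≠ 0 := by positivity
  have h := (hc.inv hne).neg
  have e : -(-(2 * t) / (γ ^ 2 + t ^ 2) ^ 2) = 2 * t / (γ ^ 2 + t ^ 2) ^ 2 := by ring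
  rw [e] at h
  exact h

/-- `integral_weight_Ioi` (line `cayley-pencil`, stub `stub_stieltjesOfPencil` support). [folklore] -/
theorem integral_weight_Ioi {γ : ℝ} (hγ : 0 < γ) :
    ∫ t in Set.Ioi (0:ℝ), 2 * t / (γ ^ 2 + t ^ 2) ^ 2 = (γ ^ 2)⁻¹ := by
  have hlim : Tendsto (fun t : ℝ => -(γ ^ 2 + t ^ 2)⁻¹) atTop (𝓝 0) := by
    have h1 : Tendsto (fun t : ℝ => γ ^ 2 + t ^ 2) atTop atTop :=
      Filter.tendsto_atTop_add_const_left _ _ (tendsto_pow_atTop two_ne_zero)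
    simpa using (tendsto_inv_atTop_zero.comp h1).neg
  rw [integral_Ioi_of_hasDerivAt_of_nonneg (a := 0) ?_ (fun t _ => hasDerivAt_neg_inv hγ t)
    (fun t ht => by have : (0:ℝ) < t := ht; positivity) hlim]
  · simp
  · exact ((hasDerivAt_neg_inv hγ 0).continuousAt).continuousWithinAt

/-- `integrableOn_weight_Ioi` (line `cayley-pencil`, stub `stub_stieltjesOfPencil` support). [folklore] -/
theorem integrableOn_weight_Ioi {γ : ℝ} (hγ : 0 < γ) :
    IntegrableOn (fun t : ℝ => 2 * t / (γ ^ 2 + t ^ 2) ^ 2) (Set.Ioi 0) := by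
  have hlim : Tendsto (fun t : ℝ => -(γ ^ 2 + t ^ 2)⁻¹) atTop (𝓝 0) := by
    have h1 : Tendsto (fun t : ℝ => γ ^ 2 + t ^ 2) atTop atTop :=
      Filter.tendsto_atTop_add_const_left _ _ (tendsto_pow_atTop two_ne_zero)
    simpa using (tendsto_inv_atTop_zero.comp h1).neg
  exact integrableOn_Ioi_deriv_of_nonneg ((hasDerivAt_neg_inv hγ 0).continuousAt).continuousWithinAt
    (fun t _ => hasDerivAt_neg_inv hγ t) (fun t ht => by have : (0:ℝ) < t := ht; positivity) hlim

/-- `integral_weight_zero_to` (line `cayley-pencil`, stub `stub_stieltjesOfPencil` support). [folklore] -/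
theorem integral_weight_zero_to {γ : ℝ} (hγ : 0 < γ) (s : ℝ) :
    ∫ t in (0:ℝ)..s, 2 * t / (γ ^ 2 + t ^ 2) ^ 2 = (γ ^ 2)⁻¹ - (γ ^ 2 + s ^ 2)⁻¹ := by
  rw [intervalIntegral.integral_eq_sub_of_hasDerivAt (f := fun t : ℝ => -(γ ^ 2 + t ^ 2)⁻¹)
    (fun t _ => hasDerivAt_neg_inv hγ t)
    (Continuous.intervalIntegrable (Continuous.div (by fun_prop) (by fun_prop)
      (fun t => by positivity)) _ _)]
  simp; ring

/-- The half-angle variable `s(θ) = √((1 - cos θ)/(1 + cos θ))` (`= |tan(θ/2)|`; junk `0` at `cos θ = -1`). [folklore] -/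
def sFn (θ : ℝ) : ℝ := Real.sqrt ((1 - Real.cos θ) / (1 + Real.cos θ))

/-- `sFn_nonneg` (line `cayley-pencil`, stub `stub_stieltjesOfPencil` support). [folklore] -/
theorem sFn_nonneg (θ : ℝ) : 0 ≤ sFn θ := Real.sqrt_nonneg _

/-- `measurable_sFn` (line `cayley-pencil`, stub `stub_stieltjesOfPencil` support). [folklore] -/
theorem measurable_sFn : Measurable sFn := by
  unfold sFn
  exact (Measurable.div (by fun_prop) (by fun_prop)).sqrt

/-- `sFn_sq` (line `cayley-pencil`, stub `stub_stieltjesOfPencil` support). [folklore] -/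
theorem sFn_sq {θ : ℝ} (_hθ : Real.cos θ ≠ -1) : sFn θ ^ 2 = (1 - Real.cos θ) / (1 + Real.cos θ) := by
  unfold sFn
  refine Real.sq_sqrt (div_nonneg ?_ ?_)
  · linarith [Real.cos_le_one θ]
  · linarith [Real.neg_one_le_cos θ]

/-- On `{cos θ ≠ -1}`: `K_γ(θ) = γ ((γ²)⁻¹ - ∫₀^{s(θ)} w_γ) = γ/(γ² + s(θ)²)`. [folklore] -/
theorem poissonFn_eq {γ : ℝ} (hγ : 0 < γ) {θ : ℝ} (hθ : Real.cos θ ≠ -1) :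
    poissonFn γ θ = γ * ((γ ^ 2)⁻¹ - ∫ t in (0:ℝ)..sFn θ, 2 * t / (γ ^ 2 + t ^ 2) ^ 2) := by
  rw [integral_weight_zero_to hγ, sub_sub_cancel, sFn_sq hθ]
  unfold poissonFn
  have h1 : 0 < 1 + Real.cos θ := by
    have := Real.neg_one_le_cos θ
    rcases this.eq_or_lt with h | h
    · exact absurd h.symm hθ
    · linarith
  have hden := poissonFn_den_pos hγ θ
  field_simp

/-- `poissonFn_eq_zero` (line `cayley-pencil`, stub `stub_stieltjesOfPencil` support). [folklore] -/
theorem poissonFn_eq_zero {γ : ℝ} {θ : ℝ} (hθ : Real.cos θ = -1) : poissonFn γ θ = 0 := by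
  unfold poissonFn; rw [hθ]; simp

/-- **Layer cake**: `∫ K_γ dρ = γ ∫₀^∞ (ρ'(univ) - ρ'{t ≤ s}) w_γ(t) dt`, `ρ' = ρ|_{cos ≠ -1}`. [folklore] -/
theorem integral_poissonFn_eq {γ : ℝ} (hγ : 0 < γ) (ρ : Measure ℝ) [IsFiniteMeasure ρ] :
    ∫ θ, poissonFn γ θ ∂ρ =
      γ * ∫ t in Set.Ioi (0:ℝ),
        ((ρ.restrict {θ | Real.cos θ ≠ -1} Set.univ).toReal -
          (ρ.restrict {θ | Real.cos θ ≠ -1} {θ | t ≤ sFn θ}).toReal) * (2 * t / (γ ^ 2 + t ^ 2) ^ 2) := by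
  set G : Set ℝ := {θ | Real.cos θ ≠ -1} with hG
  have hGm : MeasurableSet G := (isOpen_ne.preimage Real.continuous_cos).measurableSet
  set ρ' : Measure ℝ := ρ.restrict G with hρ'
  haveI : IsFiniteMeasure ρ' := by rw [hρ']; infer_instance
  set w : ℝ → ℝ := fun t => 2 * t / (γ ^ 2 + t ^ 2) ^ 2 with hw
  have hw_nonneg : ∀ t, 0 ≤ t → 0 ≤ w t := fun t ht => by rw [hw]; positivity
  have hw_cont : Continuous w := by
    rw [hw]; exact Continuous.div (by fun_prop) (by fun_prop) (fun t => by positivity)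
  -- Step 1: restrict to `G`
  have step1 : ∫ θ, poissonFn γ θ ∂ρ = ∫ θ, poissonFn γ θ ∂ρ' := by
    rw [hρ']
    refine (setIntegral_eq_integral_of_forall_compl_eq_zero fun θ hθ => ?_).symm
    have : Real.cos θ = -1 := by
      by_contra h; exact hθ h
    exact poissonFn_eq_zero this
  -- Step 2: pointwise identity on `G`
  set I : ℝ → ℝ := fun θ => ∫ t in (0:ℝ)..sFn θ, w t with hI
  have hI_eq : ∀ θ, I θ = (γ ^ 2)⁻¹ - (γ ^ 2 + sFn θ ^ 2)⁻¹ := fun θ => by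
    rw [hI]; exact integral_weight_zero_to hγ (sFn θ)
  have hI_nonneg : ∀ θ, 0 ≤ I θ := fun θ => by
    rw [hI_eq, sub_nonneg]
    exact inv_anti₀ (by positivity) (by nlinarith [sq_nonneg (sFn θ)])
  have hI_le : ∀ θ, I θ ≤ (γ ^ 2)⁻¹ := fun θ => by
    rw [hI_eq]; have : 0 ≤ (γ ^ 2 + sFn θ ^ 2)⁻¹ := by positivity
    linarith
  have hI_meas : Measurable I := by
    have : I = fun θ => (γ ^ 2)⁻¹ - (γ ^ 2 + sFn θ ^ 2)⁻¹ := funext hI_eq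
    rw [this]
    exact measurable_const.sub ((measurable_const.add (measurable_sFn.pow_const 2)).inv)
  have step2 : ∫ θ, poissonFn γ θ ∂ρ' = ∫ θ, γ * ((γ ^ 2)⁻¹ - I θ) ∂ρ' := by
    rw [hρ']
    refine setIntegral_congr_fun hGm fun θ hθ => ?_
    exact poissonFn_eq hγ hθ
  -- Step 3: split
  have hI_int : Integrable I ρ' :=
    (integrable_const ((γ ^ 2)⁻¹)).mono' hI_meas.aestronglyMeasurable
      (Eventually.of_forall fun θ => by
        rw [Real.norm_eq_abs, abs_of_nonneg (hI_nonneg θ)]; exact hI_le θ)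
  have step3 : ∫ θ, γ * ((γ ^ 2)⁻¹ - I θ) ∂ρ' = γ * ((ρ' Set.univ).toReal * (γ ^ 2)⁻¹ - ∫ θ, I θ ∂ρ') := by
    rw [integral_const_mul, integral_sub (integrable_const _) hI_int, integral_const, smul_eq_mul,
      Measure.real]
  -- Step 4: Mathlib's layer cake for `∫ I dρ'`
  have hlayer : ∫ θ, I θ ∂ρ' = ∫ t in Set.Ioi (0:ℝ), (ρ' {θ | t ≤ sFn θ}).toReal * w t := by
    have hL := lintegral_comp_eq_lintegral_meas_le_mul ρ' (f := sFn) (g := w)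
      (Eventually.of_forall sFn_nonneg) measurable_sFn.aemeasurable
      (fun t _ => hw_cont.intervalIntegrable _ _)
      ((ae_restrict_iff' measurableSet_Ioi).2 (Eventually.of_forall fun t ht => hw_nonneg t (le_of_lt ht)))
    -- left side as a Bochner integral
    rw [← ofReal_integral_eq_lintegral_ofReal hI_int (Eventually.of_forall hI_nonneg)] at hL
    -- right side as a Bochner integral
    have hm_anti : Antitone fun t : ℝ => (ρ' {θ | t ≤ sFn θ}).toReal := by
      intro a b hab
      exact ENNReal.toReal_mono (measure_ne_top _ _) (measure_mono fun θ (hθ : b ≤ sFn θ) => hab.trans hθ)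
    have hm_meas : Measurable fun t : ℝ => (ρ' {θ | t ≤ sFn θ}).toReal := hm_anti.measurable
    have hm_bdd : ∀ t, (ρ' {θ | t ≤ sFn θ}).toReal ≤ (ρ' Set.univ).toReal := fun t =>
      ENNReal.toReal_mono (measure_ne_top _ _) (measure_mono (Set.subset_univ _))
    have hmw_int : IntegrableOn (fun t => (ρ' {θ | t ≤ sFn θ}).toReal * w t) (Set.Ioi 0) := by
      refine ((integrableOn_weight_Ioi hγ).const_mul ((ρ' Set.univ).toReal)).mono'
        (hm_meas.mul hw_cont.measurable).aestronglyMeasurable ?_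
      refine (ae_restrict_iff' measurableSet_Ioi).2 (Eventually.of_forall fun t ht => ?_)
      have ht : (0:ℝ) < t := ht
      rw [Real.norm_eq_abs, abs_of_nonneg (mul_nonneg ENNReal.toReal_nonneg (hw_nonneg t ht.le))]
      exact mul_le_mul_of_nonneg_right (hm_bdd t) (hw_nonneg t ht.le)
    have hR : ∫⁻ t in Set.Ioi 0, ρ' {θ | t ≤ sFn θ} * ENNReal.ofReal (w t) =
        ENNReal.ofReal (∫ t in Set.Ioi (0:ℝ), (ρ' {θ | t ≤ sFn θ}).toReal * w t) := by
      rw [ofReal_integral_eq_lintegral_ofReal hmw_int]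
      · refine setLIntegral_congr_fun measurableSet_Ioi fun t ht => ?_
        have ht : (0:ℝ) < t := ht
        rw [ENNReal.ofReal_mul ENNReal.toReal_nonneg, ENNReal.ofReal_toReal (measure_ne_top _ _)]
      · refine (ae_restrict_iff' measurableSet_Ioi).2 (Eventually.of_forall fun t ht => ?_)
        have ht : (0:ℝ) < t := ht
        exact mul_nonneg ENNReal.toReal_nonneg (hw_nonneg t ht.le)
    rw [hR] at hL
    have hA : 0 ≤ ∫ θ, I θ ∂ρ' := integral_nonneg hI_nonneg
    have hB : 0 ≤ ∫ t in Set.Ioi (0:ℝ), (ρ' {θ | t ≤ sFn θ}).toReal * w t :=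
      setIntegral_nonneg measurableSet_Ioi fun t ht => mul_nonneg ENNReal.toReal_nonneg (hw_nonneg t (le_of_lt ht))
    exact (ENNReal.ofReal_eq_ofReal_iff hA hB).1 hL
  -- Step 5: assemble
  rw [step1, step2, step3, hlayer]
  congr 1
  have hm_anti : Antitone fun t : ℝ => (ρ' {θ | t ≤ sFn θ}).toReal := by
    intro a b hab
    exact ENNReal.toReal_mono (measure_ne_top _ _) (measure_mono fun θ (hθ : b ≤ sFn θ) => hab.trans hθ)
  have hm_meas : Measurable fun t : ℝ => (ρ' {θ | t ≤ sFn θ}).toReal := hm_anti.measurable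
  have hm_bdd : ∀ t, (ρ' {θ | t ≤ sFn θ}).toReal ≤ (ρ' Set.univ).toReal := fun t =>
    ENNReal.toReal_mono (measure_ne_top _ _) (measure_mono (Set.subset_univ _))
  have hmw_int : IntegrableOn (fun t => (ρ' {θ | t ≤ sFn θ}).toReal * w t) (Set.Ioi 0) := by
    refine ((integrableOn_weight_Ioi hγ).const_mul ((ρ' Set.univ).toReal)).mono'
      (hm_meas.mul hw_cont.measurable).aestronglyMeasurable ?_
    refine (ae_restrict_iff' measurableSet_Ioi).2 (Eventually.of_forall fun t ht => ?_)
    have ht : (0:ℝ) < t := ht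
    rw [Real.norm_eq_abs, abs_of_nonneg (mul_nonneg ENNReal.toReal_nonneg (hw_nonneg t ht.le))]
    exact mul_le_mul_of_nonneg_right (hm_bdd t) (hw_nonneg t ht.le)
  have e : (fun t => ((ρ' Set.univ).toReal - (ρ' {θ | t ≤ sFn θ}).toReal) * w t) =
      fun t => (ρ' Set.univ).toReal * w t - (ρ' {θ | t ≤ sFn θ}).toReal * w t := by
    funext t; ring
  rw [e, integral_sub ((integrableOn_weight_Ioi hγ).const_mul _) hmw_int, integral_const_mul,
    integral_weight_Ioi hγ]

/-! ### The representation -/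

/-- **`stub_stieltjesOfPencil`, general form**: for a dissipative pencil every diagonal matrix element is
`γ ∫₀^∞ Φ(t) 2t/(γ²+t²)² dt` with `Φ` monotone, vanishing on `(-∞,0]`, bounded by `‖g‖²`. [folklore] -/
theorem exists_stieltjes (hW : IsDissipativePencil W) (g : K) :
    ∃ Φ : ℝ → ℝ, Monotone Φ ∧ (∀ s : ℝ, s ≤ 0 → Φ s = 0) ∧ (∀ s : ℝ, Φ s ≤ ‖g‖ ^ 2) ∧
      ∀ γ : ℝ, 0 < γ →
        inner ℝ g (W γ g) = γ * ∫ t in Set.Ioi (0 : ℝ), Φ t * (2 * t / (γ ^ 2 + t ^ 2) ^ 2) := by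
  obtain ⟨ρ, hfin, hmass, hmom⟩ := exists_measure_of_isToeplitzPSD (isToeplitzPSD_momentSeq hW g)
  haveI := hfin
  set ρ' : Measure ℝ := ρ.restrict {θ | Real.cos θ ≠ -1} with hρ'
  haveI : IsFiniteMeasure ρ' := by rw [hρ']; infer_instance
  have hρ'univ : (ρ' Set.univ).toReal ≤ ‖g‖ ^ 2 := by
    have h1 : ρ' Set.univ ≤ ρ Set.univ := by
      rw [hρ', Measure.restrict_apply_univ]; exact measure_mono (Set.subset_univ _)
    have h2 : (ρ Set.univ).toReal = ‖g‖ ^ 2 := by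
      rw [hmass, momentSeq_zero, ENNReal.toReal_ofReal (by positivity)]
    rw [← h2]
    exact ENNReal.toReal_mono (measure_ne_top _ _) h1
  refine ⟨fun t => if 0 < t then (ρ' Set.univ).toReal - (ρ' {θ | t ≤ sFn θ}).toReal else 0,
    ?_, ?_, ?_, ?_⟩
  · -- monotone
    intro a b hab
    by_cases hb : 0 < b
    · by_cases ha : 0 < a
      · simp only [if_pos ha, if_pos hb]
        have : (ρ' {θ | b ≤ sFn θ}).toReal ≤ (ρ' {θ | a ≤ sFn θ}).toReal :=
          ENNReal.toReal_mono (measure_ne_top _ _) (measure_mono fun θ (hθ : b ≤ sFn θ) => hab.trans hθ)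
        linarith
      · simp only [if_neg ha, if_pos hb, sub_nonneg]
        exact ENNReal.toReal_mono (measure_ne_top _ _) (measure_mono (Set.subset_univ _))
    · have ha : ¬ 0 < a := fun h => hb (lt_of_lt_of_le h hab)
      simp only [if_neg ha, if_neg hb, le_refl]
  · -- vanishing on `(-∞, 0]`
    intro s hs
    simp only [if_neg (not_lt.2 hs)]
  · -- bounded by `‖g‖²`
    intro s
    by_cases hs : 0 < s
    · simp only [if_pos hs]
      have : 0 ≤ (ρ' {θ | s ≤ sFn θ}).toReal := ENNReal.toReal_nonneg
      linarith
    · simp only [if_neg hs]; positivity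
  · -- the representation
    intro γ hγ
    rw [inner_eq_integral_poissonFn hW hγ g hmom, integral_poissonFn_eq hγ ρ]
    congr 1
    refine setIntegral_congr_fun measurableSet_Ioi fun t ht => ?_
    have ht : (0:ℝ) < t := ht
    simp only [if_pos ht, hρ']

end CayleyPencilStieltjes

/-! ### The registered stub, by name and signature -/

/-- **`stub_stieltjesOfPencil` (line `cayley-pencil`, crux stmt-AtomisticToContinuum-15248), PROVED.** [folklore] -/
theorem CayleyPencilStieltjes.stieltjesOfPencil :
    ∀ (K : Type) [NormedAddCommGroup K] [InnerProductSpace ℝ K] (W : ℝ → K →L[ℝ] K),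
      (∀ γ γ' : ℝ, 0 < γ → 0 < γ' → ∀ f : K, W γ f - W γ' f = (γ' - γ) • W γ (W γ' f)) →
      (∀ γ : ℝ, 0 < γ → ∀ f : K, inner ℝ f (W γ f) = γ * ‖W γ f‖ ^ 2) →
      ∀ g : K, ∃ Φ : ℝ → ℝ, Monotone Φ ∧ (∀ s : ℝ, s ≤ 0 → Φ s = 0) ∧ (∀ s : ℝ, Φ s ≤ ‖g‖ ^ 2) ∧
        ∀ γ : ℝ, 0 < γ →
          inner ℝ g (W γ g) = γ * ∫ t in Set.Ioi (0 : ℝ), Φ t * (2 * t / (γ ^ 2 + t ^ 2) ^ 2) := by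
  intro K _ _ W hR hE g
  exact CayleyPencilStieltjes.exists_stieltjes ⟨hR, hE⟩ g

end
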